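import Literature.NumberTheory.Transcendental.ManyCurveSub
import HarnessLib

/-!
# `k`-lattice standard models: the Semistability Theorem at torsion points from its stable case

Topic `Literature/NumberTheory/Transcendental`; seventh file of the unit
`provefact-Literature.NumberTheory.Transcendental.H-0a3eb64689` (fact
`Literature.NumberTheory.Transcendental.HuberWustholzManyCurvePeriods`, `ManyCurvePeriods.lean`),
after `ManyCurveSub.lean`. It introduces NO named fact. It is the family counterpart of the second
half of the two-lattice `TwoCurveInduction.lean` (and of the one-lattice `StdSubgroups.lean` /
`SemistabilityInduction.lean`): for the family standard models `M = 𝔾ₘ^β × P` of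
`ManyCurveStd.lean` (lattice family `L : J → PeriodPair`, class map `cls : γ → J`, CM classes
carrying at most one block) it finishes the subgroup step of Baker–Wüstholz's induction
(op. cit. §6.8, p. 115) and runs the induction itself.

## What is proved here (everything; no `sorry`, no new `def … : Prop`)

* `SubData.ι_mem_ker`, `SubData.mem_AlgTors_of_ι` — the embedding `ι : Lie(model of K₀) → Lie M`
  of `ManyCurveSub.lean` maps `ker(exp)` to `ker(exp_M)` and algebraic points with torsion
  abelian part come from such points (classwise: a row of the joint family pairs the blocks of its
  own class only, `sum_mvv_cls`);
* `SubData.isKRational_comap`, `finrank_comap`, `push`, `push_tangent`, `transport` — `ι⁻¹(𝔟)` is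
  `ℚ̄`-rational, proper and semistable in the model of a BORDERLINE `K₀` (index computation of
  Baker–Wüstholz 2007, §6.7; connected algebraic subgroups of the model push forward to connected
  algebraic subgroups of `M` inside `K₀`, block-diagonality being preserved: `evvC_restr`);
* `GaGmEFam.Std.mem_ker_of_semistable_card` — **the Semistability Theorem for the family standard
  models at points with torsion abelian part, from its STABLE case, by strong induction on
  `dim M`** (quotient step `QuotData.transport` of `ManyCurveStdQuot.lean` at all division points
  + discreteness, subgroup step `SubData.transport`; the single-block condition on the CM classes
  is inherited by quotients and subgroups: `QuotData.cls'_eq_imp`, `SubData.cls'_eq_imp`);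
* `GaGmEFam.Std.semistabilityTheorem_std_tors_of_stableClosing` and
  `HuberWustholzManyCurvePeriods_of_stableClosing` — **the named fact
  `HuberWustholzManyCurvePeriods` follows from the STABLE case of Baker–Wüstholz's Thm. 6.15 for
  the family standard models at torsion points** (hypothesis `hclose`, written out inline, D-0026).

What `hclose` still needs is the two runs of Baker's method on `M` closed by Philippon's zero
estimate — the family port of the tree's one-lattice `StableClosing.mem_ker_of_stable`.

## References

* A. Baker, G. Wüstholz, *Logarithmic Forms and Diophantine Geometry*, New Math. Monogr. 9, CUP
  2007: Thm. 6.15, §6.7 (index, semistability), §6.8 (p. 115: induction over `G^*` and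
  `B ∩ ker π`; pp. 116–119). [BakerWustholz2007]
* A. Huber, G. Wüstholz, *Transcendence and Linear Relations of 1-Periods*, Cambridge Tracts 227,
  CUP 2022: Thm. 15.3 (1) (p. 145), Thm. 6.2. [HuberWustholz2022]
-/

noncomputable section

open Complex Module Submodule

namespace Literature.NumberTheory.Transcendental

namespace GaGmEFam

namespace Std

open LiePresentation
open GaGmE (Kbar linearIndependent_ofK)
open GaGmE.Std (iy iz is coords coords_iy coords_iz coords_is sum_blocks perpQ perpK
  isAlgebraic_coe_Kbar)

variable {J : Type} [Fintype J] [DecidableEq J] {β γ δ : Type}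

section Sub2

variable [Fintype β] [Fintype γ] [Fintype δ] {cls : γ → J} {κM : δ → γ → Kbar}

namespace SubData

variable {D₀ : SubgroupData β γ δ cls κM} (S : SubData D₀)

/-! ### The kernel and the algebraic points -/

/-- The lattice on a block of `M` against the joint family: a row of the joint family is supported
in its own class, so periods of the `Λ_{cls' b'}` summed down a column are periods of `Λ_{cls k}`.
[folklore] -/
theorem sum_mvv_cls (L : J → PeriodPair) (f₁ f₂ : PeriodPair → ℂ) (a b : S.B' → ℤ) (k : γ) :
    ∑ b', (S.mvv b' k : ℂ) * (a b' * f₁ (L b'.1) + b b' * f₂ (L b'.1)) =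
      ((∑ b', S.mvv b' k * a b' : ℤ) : ℂ) * f₁ (L (cls k)) +
        ((∑ b', S.mvv b' k * b b' : ℤ) : ℂ) * f₂ (L (cls k)) := by
  push_cast
  rw [Finset.sum_mul, Finset.sum_mul, ← Finset.sum_add_distrib]
  refine Finset.sum_congr rfl fun b' _ => ?_
  by_cases h : cls k = b'.1
  · rw [h]; ring
  · simp [S.mvv_supp h]

omit [Fintype J] in
/-- A sum against a row of the joint family of left inverses only sees the blocks of its class.
[folklore] -/
theorem sum_pCC_eq_sum_filter (f : γ → ℂ) (b' : S.B') :
    ∑ k, (S.pCC b' k : ℂ) * f k =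
      ∑ k ∈ Finset.univ.filter (fun k => cls k = b'.1), (S.pCC b' k : ℂ) * f k := by
  classical
  rw [Finset.sum_filter]
  refine Finset.sum_congr rfl fun k _ => ?_
  split_ifs with h
  · rfl
  · simp [pCC, h]

/-- A column sum against the joint family only sees the rows of the class of the column.
[folklore] -/
theorem sum_mvv_eq_sum_filter (f : S.B' → ℂ) (k : γ) :
    ∑ b', (S.mvv b' k : ℂ) * f b' =
      ∑ b' ∈ Finset.univ.filter (fun b' : S.B' => b'.1 = cls k), (S.mvv b' k : ℂ) * f b' := by
  classical
  rw [Finset.sum_filter]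
  refine Finset.sum_congr rfl fun b' _ => ?_
  split_ifs with h
  · rfl
  · simp [S.mvv_supp (Ne.symm h)]

/-- `ι` maps `ker(exp)` of the model of `K₀` into `ker(exp_M)`: the rows of the joint family pair
the blocks of their own class only, so periods of `Λ_i` stay periods of `Λ_i`. [folklore] -/
theorem ι_mem_ker {L : J → PeriodPair} {w : S.σ' → ℂ} (hw : w ∈ ker L S.cls' S.κS) :
    S.ι w ∈ ker L cls κM := by
  obtain ⟨hy, a, b, hz, hs⟩ := hw
  choose p hp using hy
  refine ⟨fun i => ⟨∑ j, S.av j i * p j, ?_⟩, fun k => ∑ b', S.mvv b' k * a b',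
    fun k => ∑ b', S.mvv b' k * b b', fun k => ?_, fun x => ?_⟩
  · rw [ι_iy]
    push_cast
    rw [Finset.sum_mul]
    exact Finset.sum_congr rfl fun j _ => by rw [hp j]; ring
  · rw [ι_iz]
    have e : ∑ b', (S.mvv b' k : ℂ) * w (iz b') =
        ∑ b', (S.mvv b' k : ℂ) * (a b' * (L b'.1).ω₁ + b b' * (L b'.1).ω₂) :=
      Finset.sum_congr rfl fun b' _ => by rw [hz b']
    rw [e]
    exact S.sum_mvv_cls L PeriodPair.ω₁ PeriodPair.ω₂ a b k
  · rw [ι_is]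
    have hκ : ∀ b' : S.B', (∑ k, (κM x k : ℂ) * (S.mvv b' k : ℂ)) =
        ∑ e, (S.κS e b' : ℂ) * (S.sv e x : ℂ) := by
      intro b'
      have := congrArg (algebraMap Kbar ℂ) (S.κS_spec b' x)
      simpa [map_sum, map_mul, mvv] using this
    have hcol : ∀ k : γ, ((∑ b', S.mvv b' k * a b' : ℤ) : ℂ) * (L (cls k)).η₁ +
        ((∑ b', S.mvv b' k * b b' : ℤ) : ℂ) * (L (cls k)).η₂ =
        ∑ b', (S.mvv b' k : ℂ) * (a b' * (L b'.1).η₁ + b b' * (L b'.1).η₂) :=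
      fun k => (S.sum_mvv_cls L PeriodPair.η₁ PeriodPair.η₂ a b k).symm
    simp only [hs, hcol]
    calc ∑ e, (S.sv e x : ℂ) * ∑ b', (S.κS e b' : ℂ) *
          ((a b' : ℂ) * (L b'.1).η₁ + (b b' : ℂ) * (L b'.1).η₂)
        = ∑ b', (∑ e, (S.κS e b' : ℂ) * (S.sv e x : ℂ)) *
            ((a b' : ℂ) * (L b'.1).η₁ + (b b' : ℂ) * (L b'.1).η₂) := by
          simp only [Finset.mul_sum, Finset.sum_mul]
          rw [Finset.sum_comm]
          exact Finset.sum_congr rfl fun b' _ => Finset.sum_congr rfl fun e _ => by ring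
      _ = ∑ b', (∑ k, (κM x k : ℂ) * (S.mvv b' k : ℂ)) *
            ((a b' : ℂ) * (L b'.1).η₁ + (b b' : ℂ) * (L b'.1).η₂) := by
          simp only [hκ]
      _ = ∑ k, (κM x k : ℂ) * ∑ b', (S.mvv b' k : ℂ) *
            ((a b' : ℂ) * (L b'.1).η₁ + (b b' : ℂ) * (L b'.1).η₂) := by
          simp only [Finset.sum_mul, Finset.mul_sum]
          rw [Finset.sum_comm]
          exact Finset.sum_congr rfl fun k _ => Finset.sum_congr rfl fun b' _ => by ring

/-- **Algebraic points of `K₀` with torsion abelian part come from such points of its model**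
(classwise integer combinations of `ℚ̄`-points of the `Eᵢ♮`). [folklore] -/
theorem mem_AlgTors_of_ι {L : J → PeriodPair}
    (hL : ∀ i, IsAlgebraic ℚ (L i).g₂ ∧ IsAlgebraic ℚ (L i).g₃)
    {w : S.σ' → ℂ} (hw : S.ι w ∈ AlgTors L cls κM) : w ∈ AlgTors L S.cls' S.κS := by
  classical
  obtain ⟨⟨hy, t, hzt, hs⟩, htor⟩ := hw
  have hwy : ∀ j', w (iy j') = ∑ i, (S.pA j' i : ℂ) * S.ι w (iy i) := fun j' => (S.pA_ι w j').symm
  have hwz : ∀ b', w (iz b') = ∑ k, (S.pCC b' k : ℂ) * S.ι w (iz k) := fun b' => (S.pC_ι w b').symm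
  set t'' : S.B' → ℂ := fun b' => ∑ k, (S.pCC b' k : ℂ) * t k with ht''
  set that : γ → ℂ := fun k => ∑ b', (S.mvv b' k : ℂ) * t'' b' with hthat
  have hz'' : ∀ b', (L b'.1).IsUnivExtAlgPoint (w (iz b')) (t'' b') := by
    intro b'
    rw [hwz b', ht'']
    dsimp only
    rw [S.sum_pCC_eq_sum_filter, S.sum_pCC_eq_sum_filter]
    refine PeriodPair.IsUnivExtAlgPoint.sum_int_mul (hL b'.1).1 (hL b'.1).2 _ _ _ _ fun k hk => ?_
    have hk' : cls k = b'.1 := (Finset.mem_filter.mp hk).2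
    rw [← hk']
    exact hzt k
  have hzhat : ∀ k, (L (cls k)).IsUnivExtAlgPoint (S.ι w (iz k)) (that k) := by
    intro k
    rw [ι_iz, hthat]
    dsimp only
    rw [S.sum_mvv_eq_sum_filter, S.sum_mvv_eq_sum_filter]
    refine PeriodPair.IsUnivExtAlgPoint.sum_int_mul (hL (cls k)).1 (hL (cls k)).2 _ _ _ _
      fun b' hb' => ?_
    have hb'' : b'.1 = cls k := (Finset.mem_filter.mp hb').2
    rw [← hb'']
    exact hz'' b'
  have hu : ∀ k, IsAlgebraic ℚ (t k - that k) := by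
    intro k
    have hsub := (hzt k).sub (hL (cls k)).1 (hL (cls k)).2 (hzhat k)
    rw [sub_self] at hsub
    exact hsub.isAlgebraic_of_zero
  refine ⟨⟨fun j' => ?_, t'', hz'', fun e' => ?_⟩, fun b' => ?_⟩
  · rw [hwy j', Complex.exp_sum]
    refine Finset.prod_induction _ (fun x => IsAlgebraic ℚ x) (fun a b ha hb => ha.mul hb)
      isAlgebraic_one fun i _ => ?_
    rw [Complex.exp_int_mul]
    exact isAlgebraic_zpow (hy i) _
  · set W : Fin S.nΞ → ℂ := fun e => w (is e) - ∑ b', (S.κS e b' : ℂ) * t'' b' with hW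
    show IsAlgebraic ℚ (W e')
    have hκ : ∀ b' x, (∑ k, (κM x k : ℂ) * (S.mvv b' k : ℂ)) =
        ∑ e, (S.κS e b' : ℂ) * (S.sv e x : ℂ) := by
      intro b' x
      have := congrArg (algebraMap Kbar ℂ) (S.κS_spec b' x)
      simpa [map_sum, map_mul, mvv] using this
    have hthat' : ∀ x, ∑ k, (κM x k : ℂ) * that k =
        ∑ e, (S.sv e x : ℂ) * ∑ b', (S.κS e b' : ℂ) * t'' b' := by
      intro x
      calc ∑ k, (κM x k : ℂ) * that k = ∑ b', (∑ k, (κM x k : ℂ) * (S.mvv b' k : ℂ)) * t'' b' := by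
            simp only [hthat, Finset.mul_sum, Finset.sum_mul]
            rw [Finset.sum_comm]
            exact Finset.sum_congr rfl fun b' _ => Finset.sum_congr rfl fun k _ => by ring
        _ = ∑ b', (∑ e, (S.κS e b' : ℂ) * (S.sv e x : ℂ)) * t'' b' := by simp only [hκ]
        _ = ∑ e, (S.sv e x : ℂ) * ∑ b', (S.κS e b' : ℂ) * t'' b' := by
            simp only [Finset.mul_sum, Finset.sum_mul]
            rw [Finset.sum_comm]
            exact Finset.sum_congr rfl fun e _ => Finset.sum_congr rfl fun b' _ => by ring
    have hV : ∀ x, ∑ e, (S.sv e x : ℂ) * W e =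
        (S.ι w (is x) - ∑ k, (κM x k : ℂ) * t k) + ∑ k, (κM x k : ℂ) * (t k - that k) := by
      intro x
      have e1 : ∑ e, (S.sv e x : ℂ) * W e = S.ι w (is x) - ∑ k, (κM x k : ℂ) * that k := by
        rw [hthat' x, ι_is, ← Finset.sum_sub_distrib]
        exact Finset.sum_congr rfl fun e _ => by rw [hW]; ring
      rw [e1]
      simp only [mul_sub, Finset.sum_sub_distrib]
      ring
    have hValg : ∀ x, IsAlgebraic ℚ (∑ e, (S.sv e x : ℂ) * W e) := by
      intro x
      rw [hV x]
      refine (hs x).add ?_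
      refine Finset.sum_induction _ (fun y => IsAlgebraic ℚ y) (fun a b ha hb => ha.add hb)
        isAlgebraic_zero fun k _ => (isAlgebraic_coe_Kbar (κM x k)).mul (hu k)
    let VK : δ → Kbar := fun x => ⟨∑ e, (S.sv e x : ℂ) * W e, mem_algebraicClosure_iff.mpr (hValg x)⟩
    have hVKx : ∀ x, ((VK x : Kbar) : ℂ) = ∑ e, (S.sv e x : ℂ) * W e := fun x => rfl
    have hVKmem : VK ∈ kPoints Kbar (span ℂ (ofK Kbar (L := ℂ) '' Set.range S.sv)) := by
      rw [mem_kPoints]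
      have hofK : ofK Kbar (L := ℂ) VK = ∑ e, W e • ofK Kbar (L := ℂ) (S.sv e) := by
        funext x
        rw [ofK_apply, show algebraMap Kbar ℂ (VK x) = ((VK x : Kbar) : ℂ) from rfl, hVKx x]
        simp only [Finset.sum_apply, Pi.smul_apply, smul_eq_mul, ofK_apply]
        exact Finset.sum_congr rfl fun e _ => by rw [mul_comm]; rfl
      rw [hofK]
      exact Submodule.sum_mem _ fun e _ =>
        Submodule.smul_mem _ _ (subset_span ⟨S.sv e, ⟨e, rfl⟩, rfl⟩)
    rw [kPoints_span_ofK, Submodule.mem_span_range_iff_exists_fun] at hVKmem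
    obtain ⟨c, hc⟩ := hVKmem
    have hWc : (fun e => W e - (c e : ℂ)) = 0 := by
      refine S.eq_zero_of_sv_sum fun x => ?_
      have h2 : ∑ e, (S.sv e x : ℂ) * (c e : ℂ) = ∑ e, (S.sv e x : ℂ) * W e := by
        rw [← hVKx x, show ((VK x : Kbar) : ℂ) = algebraMap Kbar ℂ (VK x) from rfl,
          ← congr_fun hc x]
        simp only [Finset.sum_apply, Pi.smul_apply, smul_eq_mul, map_sum, map_mul]
        exact Finset.sum_congr rfl fun e _ => by rw [mul_comm]; rfl
      simp only [mul_sub, Finset.sum_sub_distrib, h2, sub_self]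
    have := congr_fun hWc e'
    simp only [Pi.zero_apply, sub_eq_zero] at this
    rw [this]
    exact isAlgebraic_coe_Kbar (c e')
  · rw [hwz b', S.sum_pCC_eq_sum_filter]
    refine PeriodPair.IsTorsionPt.sum_int_mul _ _ _ fun k hk => ?_
    have hk' : cls k = b'.1 := (Finset.mem_filter.mp hk).2
    show (L b'.1).IsTorsionPt (S.ι w (iz k))
    rw [← hk']
    exact htor k

/-! ### Rationality and dimensions of `ι⁻¹(𝔟)` -/

/-- The pull-back of a `ℚ̄`-form along `ι`. [folklore] -/
def pullForm (θ : β ⊕ (γ ⊕ δ) → Kbar) : S.σ' → Kbar :=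
  coords (fun j => ∑ i, θ (iy i) * (S.av j i : Kbar)) (fun b => ∑ k, θ (iz k) * (S.mvv b k : Kbar))
    (fun e => ∑ x, θ (is x) * S.sv e x)

/-- `⟨θ, ι w⟩ = ⟨ι^*θ, w⟩`. [folklore] -/
theorem pair_ι (θ : β ⊕ (γ ⊕ δ) → Kbar) (w : S.σ' → ℂ) :
    ∑ t, (θ t : ℂ) * S.ι w t = pair Kbar (S.pullForm θ) w := by
  simp only [pair]
  rw [sum_blocks, sum_blocks]
  have hc : ∀ x : Kbar, algebraMap Kbar ℂ x = (x : ℂ) := fun x => rfl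
  congr 1
  · congr 1
    · simp only [ι_iy, pullForm, coords_iy, map_sum, map_mul, Finset.mul_sum, Finset.sum_mul]
      rw [Finset.sum_comm]
      refine Finset.sum_congr rfl fun j _ => Finset.sum_congr rfl fun i _ => ?_
      simp only [hc]; push_cast; ring
    · simp only [ι_iz, pullForm, coords_iz, map_sum, map_mul, Finset.mul_sum, Finset.sum_mul]
      rw [Finset.sum_comm]
      refine Finset.sum_congr rfl fun b _ => Finset.sum_congr rfl fun k _ => ?_
      simp only [hc]; push_cast; ring
  · simp only [ι_is, pullForm, coords_is, map_sum, map_mul, Finset.mul_sum, Finset.sum_mul]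
    rw [Finset.sum_comm]
    refine Finset.sum_congr rfl fun e _ => Finset.sum_congr rfl fun x _ => ?_
    simp only [hc]; ring

/-- **`ι⁻¹(𝔟)` is `ℚ̄`-rational** for a `ℚ̄`-rational `𝔟`. [folklore] -/
theorem isKRational_comap {𝔟 : Submodule ℂ (β ⊕ (γ ⊕ δ) → ℂ)} (hrat : IsKRational Kbar 𝔟) :
    IsKRational Kbar (𝔟.comap S.ι) := by
  obtain ⟨T, hT⟩ := hrat.dotAnn Kbar
  have h𝔟 : 𝔟 = dotAnn (dotAnn 𝔟) := (dotAnn_dotAnn 𝔟).symm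
  have e : 𝔟.comap S.ι = solSpace Kbar (S.pullForm '' T) := by
    ext w
    rw [Submodule.mem_comap, mem_solSpace]
    constructor
    · intro hw
      rintro _ ⟨θ, hθ, rfl⟩
      rw [← pair_ι]
      have hθ' : ofK Kbar (L := ℂ) θ ∈ dotAnn 𝔟 := by rw [hT]; exact subset_span ⟨θ, hθ, rfl⟩
      have := (mem_dotAnn.mp hθ') (S.ι w) hw
      rw [← this]
      exact Finset.sum_congr rfl fun t _ => by rw [ofK_apply, mul_comm]; rfl
    · intro hw
      rw [h𝔟, mem_dotAnn]
      intro θ hθ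
      rw [hT] at hθ
      induction hθ using Submodule.span_induction with
      | mem x hx =>
        obtain ⟨θ₀, hθ₀, rfl⟩ := hx
        have := hw _ ⟨θ₀, hθ₀, rfl⟩
        rw [← pair_ι] at this
        rw [← this]
        exact Finset.sum_congr rfl fun t _ => by rw [ofK_apply]; rfl
      | zero => simp
      | add x y _ _ hx hy =>
        simp only [Pi.add_apply, add_mul, Finset.sum_add_distrib, hx, hy, add_zero]
      | smul r x _ hx =>
        simp only [Pi.smul_apply, smul_eq_mul, mul_assoc, ← Finset.mul_sum, hx, mul_zero]
  rw [e]
  exact isKRational_solSpace Kbar _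

/-- `ι(ι⁻¹(𝔟)) = 𝔟 ∩ Lie K₀`. [folklore] -/
theorem map_comap (𝔟 : Submodule ℂ (β ⊕ (γ ⊕ δ) → ℂ)) :
    (𝔟.comap S.ι).map S.ι = 𝔟 ⊓ D₀.tangent := by
  rw [Submodule.map_comap_eq, S.range_ι, inf_comm]

/-- `dim ι⁻¹(𝔟) = dim(𝔟 ∩ Lie K₀)`. [folklore] -/
theorem finrank_comap (𝔟 : Submodule ℂ (β ⊕ (γ ⊕ δ) → ℂ)) :
    finrank ℂ ↥(𝔟.comap S.ι) = finrank ℂ ↥(𝔟 ⊓ D₀.tangent) := by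
  rw [← S.map_comap 𝔟]
  exact (Submodule.equivMapOfInjective S.ι S.ι_injective _).finrank_eq

/-! ### Push-forward of subgroups of the model of `K₀` to subgroups of `M` inside `K₀` -/

/-- Evaluation of rational `y`-forms on the `a⁽ʲ⁾`. [folklore] -/
def evA : (β → ℚ) →ₗ[ℚ] (Fin S.nA → ℚ) where
  toFun q := fun j => ∑ i, q i * (S.av j i : ℚ)
  map_add' a b := by funext j; simp [add_mul, Finset.sum_add_distrib]
  map_smul' c a := by funext j; simp [Finset.mul_sum, mul_assoc]

/-- Evaluation of rational `z`-forms on the joint family. [folklore] -/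
def evvC : (γ → ℚ) →ₗ[ℚ] (S.B' → ℚ) where
  toFun c := fun b => ∑ k, c k * (S.mvv b k : ℚ)
  map_add' a b := by
    funext j; simp only [Pi.add_apply, add_mul, Finset.sum_add_distrib]
  map_smul' c a := by
    funext j; simp only [Pi.smul_apply, smul_eq_mul, RingHom.id_apply, Finset.mul_sum, mul_assoc]

omit [Fintype J] in
/-- **Class restrictions commute with the evaluation on the joint family** (its rows are
supported in their classes): block-diagonality is preserved under pull-back. [folklore] -/
theorem evvC_restr (i : J) (c : γ → ℚ) : S.evvC (restr cls i c) = restr S.cls' i (S.evvC c) := by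
  funext b
  simp only [evvC, LinearMap.coe_mk, AddHom.coe_mk]
  by_cases hb : S.cls' b = i
  · rw [restr_apply_of_eq S.cls' hb]
    refine Finset.sum_congr rfl fun k _ => ?_
    by_cases hk : cls k = i
    · rw [restr_apply_of_eq cls hk]
    · rw [restr_apply_of_ne cls hk,
        S.mvv_supp (show cls k ≠ b.1 from fun h => hk (h.trans hb)), Int.cast_zero, mul_zero,
        mul_zero]
  · rw [restr_apply_of_ne S.cls' hb]
    refine Finset.sum_eq_zero fun k _ => ?_
    by_cases hk : cls k = i
    · rw [S.mvv_supp (show cls k ≠ b.1 from fun h => hb (h.symm.trans hk)), Int.cast_zero,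
        mul_zero]
    · rw [restr_apply_of_ne cls hk, zero_mul]

/-- Evaluation of `ℚ̄`-`s`-forms on the `σ⁽ᵉ⁾`. [folklore] -/
def evΞ : (δ → Kbar) →ₗ[Kbar] (Fin S.nΞ → Kbar) where
  toFun θ := fun e => ∑ x, θ x * S.sv e x
  map_add' a b := by funext e; simp [add_mul, Finset.sum_add_distrib]
  map_smul' c a := by funext e; simp [Finset.mul_sum, mul_assoc]

omit [Fintype J] in
/-- `evΞ` is onto. [folklore] -/
theorem evΞ_surjective : Function.Surjective S.evΞ := by
  classical
  have hker : LinearMap.ker S.evΞ = dotAnn (span Kbar (Set.range S.sv)) := by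
    ext θ
    rw [LinearMap.mem_ker, mem_dotAnn]
    constructor
    · intro h u hu
      induction hu using Submodule.span_induction with
      | mem x hx =>
        obtain ⟨e, rfl⟩ := hx
        have := congr_fun h e
        simp only [evΞ, LinearMap.coe_mk, AddHom.coe_mk, Pi.zero_apply] at this
        rw [← this]
        exact Finset.sum_congr rfl fun x _ => mul_comm _ _
      | zero => simp
      | add x y _ _ hx hy =>
        simp only [Pi.add_apply, add_mul, Finset.sum_add_distrib, hx, hy, add_zero]
      | smul r x _ hx =>
        simp only [Pi.smul_apply, smul_eq_mul, mul_assoc, ← Finset.mul_sum, hx, mul_zero]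
    · intro h
      funext e
      have := h (S.sv e) (subset_span ⟨e, rfl⟩)
      simp only [evΞ, LinearMap.coe_mk, AddHom.coe_mk, Pi.zero_apply]
      rw [← this]
      exact Finset.sum_congr rfl fun x _ => mul_comm _ _
  have hdim : finrank Kbar ↥(span Kbar (Set.range S.sv)) = S.nΞ := by
    rw [finrank_span_eq_card S.sv_indep, Fintype.card_fin]
  have h1 := LinearMap.finrank_range_add_finrank_ker S.evΞ
  have h2 := finrank_dotAnn_add (span Kbar (Set.range S.sv))
  rw [hker] at h1
  rw [hdim] at h2
  rw [Module.finrank_fintype_fun_eq_card] at h1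
  have hr : finrank Kbar ↥(LinearMap.range S.evΞ) = finrank Kbar (Fin S.nΞ → Kbar) := by
    rw [Module.finrank_fintype_fun_eq_card, Fintype.card_fin]; omega
  rw [← LinearMap.range_eq_top]
  exact Submodule.eq_top_of_finrank_eq hr

/-- **A `ℚ̄`-form on the `z`-directions killing the whole joint family lies in the `ℚ̄`-span of
`C₀`** (double annihilator). [folklore] -/
theorem form_mem_span_C {ψ : γ → Kbar} (hψ : ∀ b, ∑ k, ψ k * (S.mvv b k : Kbar) = 0) :
    ψ ∈ span Kbar ((fun c : γ → ℚ => fun k => (c k : Kbar)) '' (D₀.C : Set (γ → ℚ))) := by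
  set V : Submodule Kbar (γ → Kbar) := span Kbar ((fun c : γ → ℚ => fun k => (c k : Kbar)) ''
    (D₀.C : Set (γ → ℚ))) with hV
  rw [← dotAnn_dotAnn V, mem_dotAnn]
  intro u hu
  have hu' : u ∈ solSpace ℚ (L := Kbar) (D₀.C : Set (γ → ℚ)) := by
    intro c hc
    simp only [pair, eq_ratCast]
    exact (mem_dotAnn.mp hu) _ (subset_span ⟨c, hc, rfl⟩)
  rw [solSpace_eq_span] at hu'
  have hle : span Kbar (ofK ℚ (L := Kbar) ''
      {w : γ → ℚ | ∀ c ∈ (D₀.C : Set (γ → ℚ)), ∑ k, c k * w k = 0}) ≤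
      span Kbar (Set.range fun b => fun k => (S.mvv b k : Kbar)) := by
    refine span_le.mpr ?_
    rintro _ ⟨w, hw, rfl⟩
    have hw' := S.mvv_span w hw
    rw [Submodule.mem_span_range_iff_exists_fun] at hw'
    obtain ⟨r, hr⟩ := hw'
    have e : ofK ℚ (L := Kbar) w = ∑ b, (r b : Kbar) • fun k => (S.mvv b k : Kbar) := by
      funext k
      have := congr_fun hr k
      simp only [Finset.sum_apply, Pi.smul_apply, smul_eq_mul] at this
      simp only [ofK_apply, eq_ratCast, Finset.sum_apply, Pi.smul_apply, smul_eq_mul]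
      rw [← this]; push_cast; rfl
    rw [e]
    exact Submodule.sum_mem _ fun b _ => Submodule.smul_mem _ _ (subset_span ⟨b, rfl⟩)
  have hu'' := hle hu'
  rw [Submodule.mem_span_range_iff_exists_fun] at hu''
  obtain ⟨r, rfl⟩ := hu''
  simp only [Finset.sum_apply, Pi.smul_apply, smul_eq_mul, Finset.sum_mul]
  rw [Finset.sum_comm]
  refine Finset.sum_eq_zero fun b _ => ?_
  have : ∑ k, r b * (S.mvv b k : Kbar) * ψ k = r b * ∑ k, ψ k * (S.mvv b k : Kbar) := by
    rw [Finset.mul_sum]; exact Finset.sum_congr rfl fun k _ => by ring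
  rw [this, hψ b, mul_zero]

/-- The `ℚ`-linear map `c' ↦ ∑_{b'} c'_{b'} pC⁽ᵇ'⁾` over the joint family of left inverses.
[folklore] -/
def pccLin : (S.B' → ℚ) →ₗ[ℚ] (γ → ℚ) where
  toFun c' := fun k => ∑ b', c' b' * (S.pCC b' k : ℚ)
  map_add' a b := by
    funext i; simp only [Pi.add_apply, add_mul, Finset.sum_add_distrib]
  map_smul' c a := by
    funext i; simp only [Pi.smul_apply, smul_eq_mul, RingHom.id_apply, Finset.mul_sum, mul_assoc]

/-- `evvC ∘ pccLin = id` (the left inverse). [folklore] -/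
theorem evvC_pccLin (c' : S.B' → ℚ) : S.evvC (S.pccLin c') = c' := by
  classical
  funext b
  simp only [evvC, pccLin, LinearMap.coe_mk, AddHom.coe_mk, Finset.sum_mul]
  rw [Finset.sum_comm]
  have key : ∀ b', ∑ k, c' b' * (S.pCC b' k : ℚ) * (S.mvv b k : ℚ) =
      c' b' * (if b = b' then 1 else 0) := by
    intro b'
    have h := congrArg (fun n : ℤ => (n : ℚ)) (S.pCC_spec b b')
    push_cast at h
    rw [← h, Finset.mul_sum]
    exact Finset.sum_congr rfl fun k _ => by ring
  simp only [key, mul_ite, mul_one, mul_zero, Finset.sum_ite_eq, Finset.mem_univ, if_true]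

/-- The connected algebraic subgroup of `M` inside `K₀` corresponding to a connected algebraic
subgroup of the model of `K₀` (block-diagonal again, `evvC_restr`). [folklore] -/
def push (D' : SubgroupData (Fin S.nA) S.B' (Fin S.nΞ) S.cls' S.κS) :
    SubgroupData β γ δ cls κM where
  A := D'.A.comap S.evA
  C := D'.C.comap S.evvC
  blockDiag := by
    intro c hc i
    rw [Submodule.mem_comap] at hc ⊢
    rw [evvC_restr]
    exact D'.blockDiag _ hc i
  Ξ := D'.Ξ.comap S.evΞ
  compat := by
    intro θ hθ
    rw [Submodule.mem_comap] at hθ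
    have hc := D'.compat (S.evΞ θ) hθ
    set φ : γ → Kbar := fun k => ∑ x, θ x * κM x k with hφ
    set A : S.B' → Kbar := fun b' => ∑ k, φ k * (S.mvv b' k : Kbar) with hA
    set Rφ : γ → Kbar := fun k' => ∑ b', A b' * (S.pCC b' k' : Kbar) with hRφ
    have hφm : ∀ b', A b' = ∑ e, S.evΞ θ e * S.κS e b' := by
      intro b'
      rw [hA]
      simp only [hφ, evΞ, LinearMap.coe_mk, AddHom.coe_mk, Finset.sum_mul]
      rw [Finset.sum_comm]
      have hspec := S.κS_spec b'
      simp only [mul_assoc, ← Finset.mul_sum]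
      simp only [show ∀ x, ∑ k, κM x k * (S.mvv b' k : Kbar) = ∑ e, S.κS e b' * S.sv e x from
        fun x => hspec x]
      simp only [Finset.mul_sum]
      rw [Finset.sum_comm]
      exact Finset.sum_congr rfl fun e _ => Finset.sum_congr rfl fun x _ => by ring
    have hdiff : ∀ b, ∑ k, (φ k - Rφ k) * (S.mvv b k : Kbar) = 0 := by
      intro b
      have e2 : ∑ k', Rφ k' * (S.mvv b k' : Kbar) = A b := by
        simp only [hRφ, Finset.sum_mul]
        rw [Finset.sum_comm]
        have key : ∀ b', ∑ k', A b' * (S.pCC b' k' : Kbar) * (S.mvv b k' : Kbar) =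
            A b' * (if b = b' then 1 else 0) := by
          intro b'
          have h := congrArg (fun n : ℤ => (n : Kbar)) (S.pCC_spec b b')
          push_cast at h
          rw [← h, Finset.mul_sum]
          exact Finset.sum_congr rfl fun k' _ => by ring
        simp only [key, mul_ite, mul_one, mul_zero, Finset.sum_ite_eq, Finset.mem_univ, if_true]
      have e1 : ∑ k, (φ k - Rφ k) * (S.mvv b k : Kbar) =
          ∑ k, φ k * (S.mvv b k : Kbar) - ∑ k', Rφ k' * (S.mvv b k' : Kbar) := by
        rw [← Finset.sum_sub_distrib]; exact Finset.sum_congr rfl fun k _ => by ring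
      rw [e1, e2]
      exact sub_self _
    have hmono : span Kbar ((fun c : γ → ℚ => fun k => (c k : Kbar)) '' (D₀.C : Set (γ → ℚ))) ≤
        span Kbar ((fun c : γ → ℚ => fun k => (c k : Kbar)) ''
          ((D'.C.comap S.evvC : Submodule ℚ (γ → ℚ)) : Set (γ → ℚ))) := by
      refine span_mono (Set.image_mono fun c hc => ?_)
      show S.evvC c ∈ D'.C
      have : S.evvC c = 0 := by
        funext b
        exact S.mvv_perp c hc b
      rw [this]; exact Submodule.zero_mem _
    have h1 : (fun k => φ k - Rφ k) ∈
        span Kbar ((fun c : γ → ℚ => fun k => (c k : Kbar)) ''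
          ((D'.C.comap S.evvC : Submodule ℚ (γ → ℚ)) : Set (γ → ℚ))) :=
      hmono (S.form_mem_span_C hdiff)
    have h2 : Rφ ∈ span Kbar ((fun c : γ → ℚ => fun k => (c k : Kbar)) ''
        ((D'.C.comap S.evvC : Submodule ℚ (γ → ℚ)) : Set (γ → ℚ))) := by
      have hR : Rφ = ∑ b', (∑ e, S.evΞ θ e * S.κS e b') • fun k' => (S.pCC b' k' : Kbar) := by
        funext k'
        rw [hRφ, Finset.sum_apply]
        exact Finset.sum_congr rfl fun b' _ => by rw [Pi.smul_apply, smul_eq_mul, hφm b']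
      rw [hR]
      have key : ∀ lam ∈ span Kbar ((fun c : S.B' → ℚ => fun b => (c b : Kbar)) ''
          (D'.C : Set (S.B' → ℚ))),
          (∑ b', lam b' • fun k' => (S.pCC b' k' : Kbar)) ∈
            span Kbar ((fun c : γ → ℚ => fun k => (c k : Kbar)) ''
              ((D'.C.comap S.evvC : Submodule ℚ (γ → ℚ)) : Set (γ → ℚ))) := by
        intro lam hlam
        induction hlam using Submodule.span_induction with
        | mem x hx =>
          obtain ⟨c', hc', rfl⟩ := hx
          refine subset_span ⟨S.pccLin c', ?_, ?_⟩
          · show S.evvC (S.pccLin c') ∈ D'.C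
            rw [evvC_pccLin]
            exact hc'
          · funext k'
            simp [pccLin, Finset.sum_apply, Pi.smul_apply]
        | zero => simp
        | add x y _ _ hx hy =>
          simp only [Pi.add_apply, add_smul, Finset.sum_add_distrib]
          exact Submodule.add_mem _ hx hy
        | smul r x _ hx =>
          simp only [Pi.smul_apply, smul_eq_mul, ← smul_smul, ← Finset.smul_sum]
          exact Submodule.smul_mem _ _ hx
      exact key _ hc
    have hsplit : φ = (fun k => φ k - Rφ k) + Rφ := by
      funext k; simp
    rw [hsplit]
    exact Submodule.add_mem _ h1 h2

/-- `Lie(push K) = ι(Lie K)`. [folklore] -/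
theorem push_tangent (D' : SubgroupData (Fin S.nA) S.B' (Fin S.nΞ) S.cls' S.κS) :
    (S.push D').tangent = D'.tangent.map S.ι := by
  classical
  refine le_antisymm ?_ ?_
  · intro w hw
    obtain ⟨hA, hC, hΞ⟩ := (SubgroupData.mem_tangent_iff _ w).mp hw
    have hw₀ : w ∈ D₀.tangent := by
      rw [SubgroupData.mem_tangent_iff]
      refine ⟨fun q hq => hA q ?_, fun c hc => hC c ?_, fun ξ hξ => hΞ ξ ?_⟩
      · show S.evA q ∈ D'.A
        have : S.evA q = 0 := by
          funext j; simp only [evA, LinearMap.coe_mk, AddHom.coe_mk, Pi.zero_apply]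
          exact S.av_perp q hq j
        rw [this]; exact D'.A.zero_mem
      · show S.evvC c ∈ D'.C
        have : S.evvC c = 0 := by
          funext b; exact S.mvv_perp c hc b
        rw [this]; exact Submodule.zero_mem _
      · show S.evΞ ξ ∈ D'.Ξ
        have : S.evΞ ξ = 0 := by
          funext e; simp only [evΞ, LinearMap.coe_mk, AddHom.coe_mk, Pi.zero_apply]
          exact S.sv_perp ξ hξ e
        rw [this]; exact D'.Ξ.zero_mem
    obtain ⟨w', rfl⟩ := S.exists_eq_ι hw₀
    refine ⟨w', ?_, rfl⟩
    show w' ∈ D'.tangent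
    rw [SubgroupData.mem_tangent_iff]
    refine ⟨fun q' hq' => ?_, fun c' hc' => ?_, fun ξ' hξ' => ?_⟩
    · have hq : S.evA (fun i => ∑ j', q' j' * (S.pA j' i : ℚ)) = q' := by
        funext j
        simp only [evA, LinearMap.coe_mk, AddHom.coe_mk, Finset.sum_mul]
        rw [Finset.sum_comm]
        have key : ∀ j', ∑ i, q' j' * (S.pA j' i : ℚ) * (S.av j i : ℚ) =
            q' j' * (if j = j' then 1 else 0) := by
          intro j'
          have h := congrArg (fun n : ℤ => (n : ℚ)) (S.pA_spec j j')
          push_cast at h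
          rw [← h, Finset.mul_sum]
          exact Finset.sum_congr rfl fun i _ => by ring
        simp only [key, mul_ite, mul_one, mul_zero, Finset.sum_ite_eq, Finset.mem_univ, if_true]
      have := hA _ (show S.evA _ ∈ D'.A by rw [hq]; exact hq')
      rw [← this]
      simp only [Rat.cast_sum, Rat.cast_mul, Rat.cast_intCast, Finset.sum_mul]
      rw [Finset.sum_comm]
      refine Finset.sum_congr rfl fun j' _ => ?_
      rw [← S.pA_ι w' j', Finset.mul_sum]
      exact Finset.sum_congr rfl fun i _ => by ring
    · have := hC (S.pccLin c') (show S.evvC (S.pccLin c') ∈ D'.C by rw [evvC_pccLin]; exact hc')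
      rw [← this]
      simp only [pccLin, LinearMap.coe_mk, AddHom.coe_mk, Rat.cast_sum, Rat.cast_mul,
        Rat.cast_intCast, Finset.sum_mul]
      rw [Finset.sum_comm]
      refine Finset.sum_congr rfl fun b' _ => ?_
      rw [← S.pC_ι w' b', Finset.mul_sum]
      exact Finset.sum_congr rfl fun k _ => by ring
    · obtain ⟨θ, hθ⟩ := S.evΞ_surjective ξ'
      have := hΞ θ (show S.evΞ θ ∈ D'.Ξ by rw [hθ]; exact hξ')
      rw [← hθ, ← this]
      simp only [evΞ, LinearMap.coe_mk, AddHom.coe_mk, ι_is, Finset.mul_sum]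
      push_cast
      simp only [Finset.sum_mul]
      rw [Finset.sum_comm]
      exact Finset.sum_congr rfl fun x _ => Finset.sum_congr rfl fun e _ => by ring
  · rintro _ ⟨w', hw', rfl⟩
    obtain ⟨hA, hC, hΞ⟩ := (SubgroupData.mem_tangent_iff _ w').mp hw'
    rw [SubgroupData.mem_tangent_iff]
    refine ⟨fun q hq => ?_, fun c hc => ?_, fun θ hθ => ?_⟩
    · have := hA (S.evA q) hq
      simp only [evA, LinearMap.coe_mk, AddHom.coe_mk, Rat.cast_sum, Rat.cast_mul,
        Rat.cast_intCast, Finset.sum_mul] at this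
      rw [Finset.sum_comm] at this
      simp only [ι_iy, Finset.mul_sum]
      rw [← this]
      exact Finset.sum_congr rfl fun i _ => Finset.sum_congr rfl fun j _ => by ring
    · have hc' : S.evvC c ∈ D'.C := hc
      have := hC (S.evvC c) hc'
      simp only [evvC, LinearMap.coe_mk, AddHom.coe_mk, Rat.cast_sum, Rat.cast_mul,
        Rat.cast_intCast, Finset.sum_mul] at this
      rw [Finset.sum_comm] at this
      simp only [ι_iz, Finset.mul_sum]
      rw [← this]
      exact Finset.sum_congr rfl fun k _ => Finset.sum_congr rfl fun b _ => by ring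
    · have := hΞ (S.evΞ θ) hθ
      simp only [evΞ, LinearMap.coe_mk, AddHom.coe_mk] at this
      push_cast at this
      simp only [Finset.sum_mul] at this
      rw [Finset.sum_comm] at this
      simp only [ι_is, Finset.mul_sum]
      rw [← this]
      exact Finset.sum_congr rfl fun x _ => Finset.sum_congr rfl fun e _ => by ring

/-- `Lie(push K) ⊆ Lie K₀`. [folklore] -/
theorem push_tangent_le (D' : SubgroupData (Fin S.nA) S.B' (Fin S.nΞ) S.cls' S.κS) :
    (S.push D').tangent ≤ D₀.tangent := by
  rw [push_tangent, ← S.range_ι]; exact LinearMap.map_le_range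

/-! ### The transport theorem (borderline subgroups) -/

/-- **Transport to a borderline subgroup.** Let `𝔟 ⊊ Lie M` be `ℚ̄`-rational and semistable, and
`0 ≠ K₀ ≠ M` a connected algebraic subgroup which is BORDERLINE for `𝔟`. Then `ι⁻¹(𝔟)` is
`ℚ̄`-rational, proper, and semistable in the model of `K₀` (verbatim from
`GaGmE.Std.SubData.transport`). [cite: BakerWustholz2007, §6.7 (index), §6.8 (p. 115: "B ∩ ker π and ker π")] -/
theorem transport {𝔟 : Submodule ℂ (β ⊕ (γ ⊕ δ) → ℂ)} (hrat : IsKRational Kbar 𝔟) (h𝔟 : 𝔟 ≠ ⊤)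
    (hss : Semistable cls κM 𝔟) (hD₀top : D₀.tangent ≠ ⊤) (hD₀bot : D₀.tangent ≠ ⊥)
    (hbord : finrank ℂ 𝔟 * (Fintype.card (β ⊕ (γ ⊕ δ)) - finrank ℂ D₀.tangent) =
      (finrank ℂ 𝔟 - finrank ℂ ↥(𝔟 ⊓ D₀.tangent)) * Fintype.card (β ⊕ (γ ⊕ δ))) :
    IsKRational Kbar (𝔟.comap S.ι) ∧ 𝔟.comap S.ι ≠ ⊤ ∧ Semistable S.cls' S.κS (𝔟.comap S.ι) := by
  set n := Fintype.card (β ⊕ (γ ⊕ δ)) with hn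
  set d := finrank ℂ 𝔟 with hd
  set k₀ := finrank ℂ D₀.tangent with hk₀
  set i₀ := finrank ℂ ↥(𝔟 ⊓ D₀.tangent) with hi₀
  have hcard : Fintype.card S.σ' = k₀ := S.card_eq
  have hdim𝔟' : finrank ℂ ↥(𝔟.comap S.ι) = i₀ := S.finrank_comap 𝔟
  have hdlt : d < n := by have := Submodule.finrank_lt h𝔟; simpa [hn, hd] using this
  have hk₀n : k₀ ≤ n := by have := Submodule.finrank_le D₀.tangent; simpa [hn, hk₀] using this
  have hi₀d : i₀ ≤ d := Submodule.finrank_mono inf_le_left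
  have hi₀k : i₀ ≤ k₀ := Submodule.finrank_mono inf_le_right
  have hnpos : 0 < n := by omega
  have h1 : IsKRational Kbar (𝔟.comap S.ι) := S.isKRational_comap hrat
  have h2 : 𝔟.comap S.ι ≠ ⊤ := by
    intro htop
    have hle : D₀.tangent ≤ 𝔟 := by
      intro w hw
      obtain ⟨w', rfl⟩ := S.exists_eq_ι hw
      have : w' ∈ 𝔟.comap S.ι := by rw [htop]; exact Submodule.mem_top
      exact this
    have h0 := hss.finrank_eq_zero_of_le h𝔟 D₀ hle
    exact hD₀bot (Submodule.finrank_eq_zero.mp h0)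
  have h3 : Semistable S.cls' S.κS (𝔟.comap S.ι) := by
    rintro _ ⟨D', rfl⟩ h𝔨'top
    set P := (S.push D').tangent with hP
    have hPle : P ≤ D₀.tangent := S.push_tangent_le D'
    have hPeq : P = D'.tangent.map S.ι := S.push_tangent D'
    have hPtop : P ≠ ⊤ := fun h => hD₀top (eq_top_iff.mpr (h ▸ hPle))
    have hssP := hss P ⟨S.push D', rfl⟩ hPtop
    set k := finrank ℂ P with hk
    set i := finrank ℂ ↥(𝔟 ⊓ P) with hi
    have hkeq : finrank ℂ ↥D'.tangent = k := by
      rw [hk, hPeq]; exact (Submodule.equivMapOfInjective S.ι S.ι_injective _).finrank_eq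
    have hieq : finrank ℂ ↥(𝔟.comap S.ι ⊓ D'.tangent) = i := by
      have e1 : (𝔟.comap S.ι ⊓ D'.tangent).map S.ι = 𝔟 ⊓ P := by
        rw [Submodule.map_inf S.ι S.ι_injective, S.map_comap, ← hPeq, inf_assoc,
          inf_eq_right.mpr hPle]
      rw [hi, ← e1]
      exact (Submodule.equivMapOfInjective S.ι S.ι_injective _).finrank_eq
    have hkk₀ : k ≤ k₀ := Submodule.finrank_mono hPle
    have hii₀ : i ≤ i₀ := Submodule.finrank_mono (inf_le_inf_left 𝔟 hPle)
    have hid : i ≤ d := Submodule.finrank_mono inf_le_left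
    have hkn : k ≤ n := hkk₀.trans hk₀n
    rw [hcard, hdim𝔟', hkeq, hieq]
    change d * (n - k) ≤ (d - i) * n at hssP
    have e1 : d * k₀ = i₀ * n := by
      zify [hk₀n, hi₀d] at hbord
      zify
      linear_combination -hbord
    have e2 : i * n ≤ d * k := by
      zify [hkn, hid] at hssP
      zify
      linarith
    have e3 : i * k₀ ≤ i₀ * k := by
      have : n * (i * k₀) ≤ n * (i₀ * k) := by
        calc n * (i * k₀) = k₀ * (i * n) := by ring
          _ ≤ k₀ * (d * k) := Nat.mul_le_mul_left _ e2
          _ = k * (d * k₀) := by ring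
          _ = k * (i₀ * n) := by rw [e1]
          _ = n * (i₀ * k) := by ring
      exact Nat.le_of_mul_le_mul_left this hnpos
    zify [hkk₀, hii₀]
    zify at e3
    nlinarith [e3]
  exact ⟨h1, h2, h3⟩

end SubData

end Sub2

/-! ### The Semistability Theorem (torsion abelian part) from the stable case, by induction -/

section Induction

/-- **The Semistability Theorem for the family standard models at points with torsion abelian
part, at dimension `n`, by strong induction on `n`, from the STABLE case** (the explicit
hypothesis `hclose`: Baker–Wüstholz's Thm. 6.15 for a `ℚ̄`-rational proper semistable `𝔟` for
which no connected algebraic `0 ≠ K ≠ M` with `ℚ̄`-data is borderline — in print the two runs of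
Baker's method, op. cit. pp. 116–119; for ONE lattice `GaGmE.Std.mem_ker_of_stable`). The
induction is that of `GaGmE.Std.mem_ker_of_semistable_card` verbatim: over a borderline `K₀` pass
to the quotient `M/K₀` (`QuotData.transport`) at all division points `w/m`, conclude `w ∈ Lie K₀`
by discreteness, then pass to the subgroup `K₀` (`SubData.transport`); the single-block condition
on the CM classes passes to both (`QuotData.cls'_eq_imp`, `SubData.cls'_eq_imp`).
[cite: BakerWustholz2007, Thm. 6.15, §6.8 (p. 115: induction over G^* and B ∩ ker π; pp. 116–119)] -/
theorem mem_ker_of_semistable_card {L : J → PeriodPair}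
    (hclose : ∀ (β γ δ : Type) [Fintype β] [Fintype γ] [Fintype δ] (cls : γ → J),
      (∀ b b', cls b = cls b' → (L (cls b)).HasCM → b = b') →
      ∀ (κM : δ → γ → Kbar) (𝔟 : Submodule ℂ (β ⊕ (γ ⊕ δ) → ℂ)),
      IsKRational Kbar 𝔟 → 𝔟 ≠ ⊤ → Semistable cls κM 𝔟 →
      (∀ D : SubgroupData β γ δ cls κM, D.tangent ≠ ⊤ → D.tangent ≠ ⊥ →
        finrank ℂ 𝔟 * (Fintype.card (β ⊕ (γ ⊕ δ)) - finrank ℂ D.tangent) ≠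
          (finrank ℂ 𝔟 - finrank ℂ ↥(𝔟 ⊓ D.tangent)) * Fintype.card (β ⊕ (γ ⊕ δ))) →
      ∀ w ∈ 𝔟, w ∈ AlgTors L cls κM → w ∈ ker L cls κM)
    (hL : ∀ i, IsAlgebraic ℚ (L i).g₂ ∧ IsAlgebraic ℚ (L i).g₃) (n : ℕ) :
    ∀ (β γ δ : Type) [Fintype β] [Fintype γ] [Fintype δ] (cls : γ → J),
      (∀ b b', cls b = cls b' → (L (cls b)).HasCM → b = b') →
      ∀ (κM : δ → γ → Kbar) (𝔟 : Submodule ℂ (β ⊕ (γ ⊕ δ) → ℂ)),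
      Fintype.card (β ⊕ (γ ⊕ δ)) = n →
      IsKRational Kbar 𝔟 → 𝔟 ≠ ⊤ → Semistable cls κM 𝔟 →
      ∀ w ∈ 𝔟, w ∈ AlgTors L cls κM → w ∈ ker L cls κM := by
  induction n using Nat.strong_induction_on with
  | _ n ih =>
  intro β γ δ _ _ _ cls hcm1 κM 𝔟 hn hrat h𝔟 hss w hw𝔟 hw
  classical
  by_cases hbord : ∃ D : SubgroupData β γ δ cls κM, D.tangent ≠ ⊤ ∧ D.tangent ≠ ⊥ ∧
      finrank ℂ 𝔟 * (Fintype.card (β ⊕ (γ ⊕ δ)) - finrank ℂ D.tangent) =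
        (finrank ℂ 𝔟 - finrank ℂ ↥(𝔟 ⊓ D.tangent)) * Fintype.card (β ⊕ (γ ⊕ δ))
  · -- a borderline `0 ≠ K₀ ≠ M`: induct over `M/K₀` and `K₀`
    obtain ⟨D₀, hD₀top, hD₀bot, hD₀bord⟩ := hbord
    have hk₀lt : finrank ℂ ↥D₀.tangent < n := by
      have := Submodule.finrank_lt hD₀top; simpa [hn] using this
    -- Step 1: `w ∈ Lie K₀`, through the quotient `M/K₀` at all division points `w/m`
    obtain ⟨Q⟩ := nonempty_quotData D₀
    obtain ⟨hrat', htop', hss'⟩ := Q.transport hrat h𝔟 hss hD₀top hD₀bord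
    have hcard' : Fintype.card Q.σ' < n := by
      have hk₀pos : 0 < finrank ℂ ↥D₀.tangent := by
        rw [Nat.pos_iff_ne_zero, Ne, Submodule.finrank_eq_zero]; exact hD₀bot
      have := Q.card_eq; rw [hn] at this; omega
    have hwD₀ : w ∈ D₀.tangent := by
      refine D₀.mem_tangent_of_forall_exists (L := L) w fun m hm => ?_
      have hwm : (m : ℂ)⁻¹ • w ∈ AlgTors L cls κM := inv_natCast_smul_mem_AlgTors hL hw hm
      have hwm𝔟 : (m : ℂ)⁻¹ • w ∈ 𝔟 := Submodule.smul_mem _ _ hw𝔟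
      have hΦ : Q.Φ ((m : ℂ)⁻¹ • w) ∈ ker L Q.cls' Q.κM' :=
        ih _ hcard' (Fin Q.nA) Q.B' (Fin Q.nΞ) Q.cls' (Q.cls'_eq_imp hcm1) Q.κM' (𝔟.map Q.Φ)
          rfl hrat' htop' hss' _ (Submodule.mem_map_of_mem hwm𝔟) (Q.Φ_mem_AlgTors hL hwm)
      obtain ⟨k, hk, hh⟩ := Q.exists_ker_of_Φ_mem_ker hΦ
      refine ⟨k, hk, (m : ℂ)⁻¹ • w - k, hh, ?_⟩
      have hm0 : (m : ℂ) ≠ 0 := by exact_mod_cast hm.ne'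
      rw [add_sub_cancel, smul_smul, mul_inv_cancel₀ hm0, one_smul]
    -- Step 2: transport to the subgroup `K₀`
    obtain ⟨S⟩ := nonempty_subData D₀
    obtain ⟨hratS, htopS, hssS⟩ := S.transport hrat h𝔟 hss hD₀top hD₀bot hD₀bord
    have hcardS : Fintype.card S.σ' < n := by rw [S.card_eq]; exact hk₀lt
    obtain ⟨w', hw'⟩ := S.exists_eq_ι hwD₀
    have hw'𝔟 : w' ∈ 𝔟.comap S.ι := by show S.ι w' ∈ 𝔟; rw [hw']; exact hw𝔟
    have hw'alg : w' ∈ AlgTors L S.cls' S.κS := S.mem_AlgTors_of_ι hL (by rw [hw']; exact hw)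
    have hker' := ih _ hcardS (Fin S.nA) S.B' (Fin S.nΞ) S.cls' (S.cls'_eq_imp hcm1) S.κS
      (𝔟.comap S.ι) rfl hratS htopS hssS w' hw'𝔟 hw'alg
    rw [← hw']
    exact S.ι_mem_ker hker'
  · -- `𝔟` is stable
    push Not at hbord
    exact hclose β γ δ cls hcm1 κM 𝔟 hrat h𝔟 hss (fun D h1 h2 => hbord D h1 h2) w hw𝔟 hw

end Induction

end Std

end GaGmEFam

/-! ### The reductions -/

open GaGmEFam GaGmEFam.Std in
/-- **The Semistability Theorem for the family standard models at points with torsion abelian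
part follows from its stable case** (both written out in full; D-0026: no named fact).
[cite: BakerWustholz2007, Thm. 6.15, §6.8] -/
theorem GaGmEFam.Std.semistabilityTheorem_std_tors_of_stableClosing
    (hclose : ∀ (J : Type) [Fintype J] [DecidableEq J] (L : J → PeriodPair),
      (∀ i, IsAlgebraic ℚ (L i).g₂ ∧ IsAlgebraic ℚ (L i).g₃) →
      (∀ i j, i ≠ j → ¬ (L i).IsIsogenousTo (L j)) →
      ∀ (β γ δ : Type) [Fintype β] [Fintype γ] [Fintype δ] (cls : γ → J),
        (∀ b b', cls b = cls b' → (L (cls b)).HasCM → b = b') →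
        ∀ (κM : δ → γ → GaGmE.Kbar) (𝔟 : Submodule ℂ (β ⊕ (γ ⊕ δ) → ℂ)),
        LiePresentation.IsKRational GaGmE.Kbar 𝔟 → 𝔟 ≠ ⊤ → Semistable cls κM 𝔟 →
        (∀ D : SubgroupData β γ δ cls κM, D.tangent ≠ ⊤ → D.tangent ≠ ⊥ →
          finrank ℂ 𝔟 * (Fintype.card (β ⊕ (γ ⊕ δ)) - finrank ℂ D.tangent) ≠
            (finrank ℂ 𝔟 - finrank ℂ ↥(𝔟 ⊓ D.tangent)) * Fintype.card (β ⊕ (γ ⊕ δ))) →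
        ∀ w ∈ 𝔟, w ∈ AlgTors L cls κM → w ∈ GaGmEFam.Std.ker L cls κM) :
    ∀ (J : Type) [Fintype J] [DecidableEq J] (L : J → PeriodPair),
      (∀ i, IsAlgebraic ℚ (L i).g₂ ∧ IsAlgebraic ℚ (L i).g₃) →
      (∀ i j, i ≠ j → ¬ (L i).IsIsogenousTo (L j)) →
      ∀ (β γ δ : Type) [Fintype β] [Fintype γ] [Fintype δ] (cls : γ → J),
        (∀ b b', cls b = cls b' → (L (cls b)).HasCM → b = b') →
        ∀ (κM : δ → γ → GaGmE.Kbar) (𝔟 : Submodule ℂ (β ⊕ (γ ⊕ δ) → ℂ)),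
        LiePresentation.IsKRational GaGmE.Kbar 𝔟 → 𝔟 ≠ ⊤ → Semistable cls κM 𝔟 →
        ∀ w ∈ 𝔟, w ∈ AlgTors L cls κM → w ∈ GaGmEFam.Std.ker L cls κM :=
  fun J _ _ L hL hiso β γ δ _ _ _ cls hcm1 κM 𝔟 hrat h𝔟 hss w hw𝔟 hw =>
    mem_ker_of_semistable_card (hclose J L hL hiso) hL _ β γ δ cls hcm1 κM 𝔟 rfl hrat h𝔟 hss
      w hw𝔟 hw

open GaGmEFam GaGmEFam.Std in
/-- **Reduction of the `2 + 4k` 1-periods to the STABLE case of the Semistability Theorem for the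
family standard models.** The named fact `HuberWustholzManyCurvePeriods` (Huber–Wüstholz 2022,
Thm. 15.3 (1) for `[ℤ →⁰ 𝔾ₘ] × E₁ × ⋯ × E_k`, `δ = 2 + ∑ᵢ 4/e(Eᵢ)`) follows from Baker–Wüstholz's
Thm. 6.15 for the family standard models `𝔾ₘ^β × P` (finite families of pairwise non-isogenous
lattices with algebraic invariants, block structures whose CM classes carry at most one block)
restricted to STABLE `ℚ̄`-rational proper semistable `𝔟` (no borderline connected algebraic
`0 ≠ K ≠ M`) at the algebraic points of `exp(𝔟_ℂ)` with torsion abelian part — the statement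
`hclose`, written out inline (D-0026). Everything between `hclose` and the periods (the induction
over borderline quotients and subgroups, the transport of the hyperplane theorem to the
quotients, the dévissage at the period point, the CM normal form) is proved in the tree. What
`hclose` still needs is the two runs of Baker's method on `M` (auxiliary theta polynomial, Siegel,
extrapolation, Liouville, the two dichotomies) closed by Philippon's zero estimate on `M` — the
family port of the tree's one-lattice `StableClosing.mem_ker_of_stable`.
[cite: HuberWustholz2022, Thm. 15.3 (1)] [cite: BakerWustholz2007, Thm. 6.15, §6.7, §6.8] -/
theorem HuberWustholzManyCurvePeriods_of_stableClosing
    (hclose : ∀ (J : Type) [Fintype J] [DecidableEq J] (L : J → PeriodPair),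
      (∀ i, IsAlgebraic ℚ (L i).g₂ ∧ IsAlgebraic ℚ (L i).g₃) →
      (∀ i j, i ≠ j → ¬ (L i).IsIsogenousTo (L j)) →
      ∀ (β γ δ : Type) [Fintype β] [Fintype γ] [Fintype δ] (cls : γ → J),
        (∀ b b', cls b = cls b' → (L (cls b)).HasCM → b = b') →
        ∀ (κM : δ → γ → GaGmE.Kbar) (𝔟 : Submodule ℂ (β ⊕ (γ ⊕ δ) → ℂ)),
        LiePresentation.IsKRational GaGmE.Kbar 𝔟 → 𝔟 ≠ ⊤ → Semistable cls κM 𝔟 →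
        (∀ D : SubgroupData β γ δ cls κM, D.tangent ≠ ⊤ → D.tangent ≠ ⊥ →
          finrank ℂ 𝔟 * (Fintype.card (β ⊕ (γ ⊕ δ)) - finrank ℂ D.tangent) ≠
            (finrank ℂ 𝔟 - finrank ℂ ↥(𝔟 ⊓ D.tangent)) * Fintype.card (β ⊕ (γ ⊕ δ))) →
        ∀ w ∈ 𝔟, w ∈ AlgTors L cls κM → w ∈ GaGmEFam.Std.ker L cls κM) :
    HuberWustholzManyCurvePeriods :=
  HuberWustholzManyCurvePeriods_of_std_tors (semistabilityTheorem_std_tors_of_stableClosing hclose)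

end Literature.NumberTheory.Transcendental

end
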